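import Literature.NumberTheory.LFunctions.Zhang2022.DetectorGlueForm

/-!
# Zhang (2022), programme F-S3 (cell landau-siegel, family B-ell, item N2): the formula-II glue block AT FINITE `A`
# — the `t₀`-frame / `T`-frame residue bookkeeping of D-ELL-1c-II and its ASSEMBLY, kernel-checked
# («the `T`-frame cancels identically»; finite-`A` weights `𝒲_j(b, ℓ′)`; split-independence identity)

Y. Zhang, *Discrete mean estimates and the Landau–Siegel zero*, arXiv:2211.02515v3 [Zhang2022LandauSiegel] — an
unrefereed manuscript under adjudication. **WHAT THIS IS NOT: not a claim about Theorems 1–2 of arXiv:2211.02515,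
about Landau–Siegel zeros, or about Parity; nothing here asserts any claim of the manuscript.**
«The programme SEARCHES and TYPES; no claim about Landau–Siegel zeros, Theorems 1–2 of arXiv:2211.02515 or a
repaired Margin232 until a kernel theorem says so.»

WHAT.  `DetectorGlueForm` kernel-checks the ASSEMBLY of the manuscript's formula-II cross block `Ξ₁₄ = −i(Φ₁+Φ₂−Φ₃)`
((13.7); §15 `Φ₁`, §16 `Φ₂`, §17 `Φ₃`) for a general shift triple `b` with ALL frame phases at their printed limits
(`Det.glueAssembled_eq`: the pieces sum to `−i[Σ_j W′_j(b)𝔢_j + c₀(b)𝔢*]`, `W′ = Det.shiftGlueW`, `c₀ = Det.shiftGlue0`).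
The B-ell derivation D-ELL-1c-II (ls-Bell-deriv-1 g2, STRUCTURE line 2026-08-27T01:44:10Z on the cell bus; file
`B-ell/deriv-1/D-ELL-1c-II.md`) keeps TWO frame parameters finite — the `t₀`-frame `ℓ′ := log(p t₀)/log P = 1 + τ₀/(2A)`
(phases `(pt₀)^{β} ↦ Φ(b·ℓ′)`, `Φ(x) = e^{iπx}` = `Det.glPhase`) and the `T`-frame `Z := log T²/log P = 2B_T/A` (the
`z`-extent of the factors `N(s+β,ψ)` of length `T²`; `K`-frame `ℓ₄ := log P₄/log P = ℓ′ − Z`, `P₄ = PT⁻²t₀`) — and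
states: (P3) each `N(s+β_N)` factor against a partner of twist `b_X` contributes
`𝒩(b_X, b_N; Z) = [b_X Φ((b_X−b_N)Z) − b_N]/(b_X − b_N)`, and WITH `ℓ₄ = ℓ′ − Z` THE `T`-FRAME CANCELS IDENTICALLY in
`Φ₁+Φ₂−Φ₃`, the result being `F0_A = −i{Σ_j 𝒲_j(A)·e_{b_j}(a)e_{b_j}(b′) − Φ(b₃ℓ′)·a(0⁺)b′(0⁺)}` with
`𝒲_j(A) = Φ((b₃−b_j)ℓ′)·Π_{k≠j}b_k/Π_{k≠j}(b_k−b_j)`; (P5) `b_j·𝒲_j(A) = W_j(b;ℓ′)·b′_jb″_j` with the finite-`A` formula-I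
weights `W_j(b;ℓ′) = b_jΦ((b₃−b_j)ℓ′)/Π_{k≠j}(b_k−b_j)` of D-ELL-1-K0 (R4).

THIS FILE types the finite-`A` pieces (channels `(0,1,2)` here = the note's `(1,2,3)`; `b 2` = the apex shift `b₃`) for
a GENERAL pairwise-distinct triple — with the §16 / §17 frame phases written RELATIVELY, `Φ((b₂−b₁)ℓ′)` and
`Φ((b₂−b₀)ℓ′)` (the `t₀`-frame continuation of GLUE-DERIVATION's `Φ(b₂−b₁)`, `Φ(b₂−b₀)`), which ON ZHANG'S DETUNING RAY
`b(A) = (1,2,3) + (πc′/A)(−5,2,−3)` (`b₂ = b₀ + b₁`, where also `Det.gluePhi0 = 1`) are `Φ(b₀ℓ′)`, `Φ(b₁ℓ′)` = the note's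
display verbatim (`glueV0A_ray`, `glueV1A_ray`, `glueT0A_ray`, `gluePhi0_ray`) — and PROVES (P3) for every
pairwise-distinct triple with `b₀ ≠ 0` and (P5) for every triple:

* `nFac bX bN Z` = `𝒩(b_X,b_N;Z)`, `nFac_zero` (`= 1` at `Z = 0`); `glueWA b ℓ′ j` = `𝒲_j`; `ellWA b ℓ′ j` = `W_j(b;ℓ′)`;
* the finite-`A` pieces `glueUA` (§15, phases at `ℓ₄`), `glueV0A`/`glueV1A` (§16, phase `Φ((b₂−b₁)ℓ′)`, `N`-factors
  `𝒩(b₀,b₂;Z)`, `𝒩(b₁,b₂;Z)`), `glueT0A` (§17 `Φ₃⁻`: `Φ((b₂−b₀)ℓ′)𝒩(b₀,b₁;Z)𝒩(b₀,b₂;Z)`), apex `Φ(b₂ℓ′)`, and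
  `glueAssembledA b ℓ′ Z e e0 = −i{Σ_j glueUA_j(ℓ′−Z) e_j + glueV0A e₀ + glueV1A e₁ − Φ(b₂ℓ′) e* + glueT0A e₀}`;
* **`glueAssembledA_eq`** (P3): for every pairwise-distinct non-zero triple, EVERY `ℓ′` and EVERY `Z`,
  `glueAssembledA b ℓ′ Z e e0 = −i{Σ_j 𝒲_j(b,ℓ′) e_j − Φ(b₂ℓ′) e*}` — hence **`glueAssembledA_T_frame_cancels`**
  (`… Z … = … 0 …`): `B_T` is NOT a first-order datum of the cross block (frame rule R6 extended to formula II);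
* **`bj_mul_glueWA`** (P5): `b_j·𝒲_j(b,ℓ′) = W_j(b;ℓ′)·n_j(b)` (all `b`, `ℓ′`);
* faithfulness to the tree's limit objects: `glueAssembledA_one_zero` (at `ℓ′ = 1`, `Z = 0` it IS `Det.glueAssembled`
  up to GLUE-DERIVATION's global phase `Φ₀ = Det.gluePhi0 b`; `glueAssembledA_one_zero_ray`: on the nose on the ray),
  `glueWA_one_eq_shiftGlueW` / `ellWA_one_eq_shiftW` / `neg_glPhase_apex_eq_shiftGlue0` (at `ℓ′ = 1` on the ray the
  finite-`A` pair is the cell's glue pair `(shiftGlueW, shiftGlue0)`), `glueWA_std` (`= (3,3,1)` = `zhangGlueW` at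
  `b = (1,2,3)`, `ℓ′ = 1`), and `glueAssembledA_eq_F0DetC` (on profile data it is the free-pair block `Det.F0DetC` with
  the finite-`A` pair).

DERIVATION STATUS.  The READING of the residues (which phase/`N`-factor sits on which channel) is D-ELL-1c-II's
(label DERIVATION/HEUR until ls-theory's review; referee ls-B-ref-2); what is PROVED here is the finite algebra given
that reading — exactly as `Det.glueAssembled_eq` proves GLUE-DERIVATION §1(f) given §1(a)–(e). No number of the cell
enters; definitions with bodies and theorems only (no named fact).

## References
* Y. Zhang, arXiv:2211.02515v3 (2022): §13 (13.7)–(13.10); §15 (15.15)–(15.17), (15.24); §16 (16.13)–(16.17);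
  §17 (17.1)–(17.10); Lemma 5.1–5.2; (2.10), (2.13), (2.30). [Zhang2022LandauSiegel]
-/

noncomputable section

open Complex Real

namespace Literature.NumberTheory.LFunctions.Zhang2022

namespace Det

open Repair

/-! ### Phase algebra (`Φ(x) = e^{iπx}`) -/

/-- `Φ(0) = 1`. [cite: Zhang2022LandauSiegel, §2 (2.10)] -/
theorem glPhase_zero : glPhase 0 = 1 := by simp [glPhase]

/-- `Φ(x + y) = Φ(x)Φ(y)`. [cite: Zhang2022LandauSiegel, §2 (2.10)] -/
theorem glPhase_add (x y : ℝ) : glPhase (x + y) = glPhase x * glPhase y := (glPhase_mul x y).symm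

/-- `Φ(−x) = Φ(x)⁻¹`. [cite: Zhang2022LandauSiegel, §2 (2.10)] -/
theorem glPhase_neg (x : ℝ) : glPhase (-x) = (glPhase x)⁻¹ := by
  have h : glPhase x * glPhase (-x) = 1 := by rw [glPhase_mul, add_neg_cancel, glPhase_zero]
  exact eq_inv_of_mul_eq_one_right h

/-- `Φ(x − y) = Φ(x)Φ(y)⁻¹`. [cite: Zhang2022LandauSiegel, §2 (2.10)] -/
theorem glPhase_sub (x y : ℝ) : glPhase (x - y) = glPhase x * (glPhase y)⁻¹ := by
  rw [sub_eq_add_neg, glPhase_add, glPhase_neg]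

/-- `Φ((x − y)t) = Φ(xt)Φ(yt)⁻¹`. [cite: Zhang2022LandauSiegel, §2 (2.10)] -/
theorem glPhase_sub_mul (x y t : ℝ) : glPhase ((x - y) * t) = glPhase (x * t) * (glPhase (y * t))⁻¹ := by
  rw [sub_mul, glPhase_sub]

/-- `Φ(x(s − t)) = Φ(xs)Φ(xt)⁻¹`. [cite: Zhang2022LandauSiegel, §2 (2.10)] -/
theorem glPhase_mul_sub (x s t : ℝ) : glPhase (x * (s - t)) = glPhase (x * s) * (glPhase (x * t))⁻¹ := by
  rw [mul_sub, glPhase_sub]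

/-! ### The `T`-frame `N`-factor and the finite-`A` weights -/

/-- **The `N`-factor of D-ELL-1c-II (P3):** `𝒩(b_X, b_N; Z) = [b_X·Φ((b_X − b_N)Z) − b_N]/(b_X − b_N)` — the
contribution of one factor `N(s+β_N, ψ)` (length `T²`, `z`-extent `Z = log T²/log P`) against a partner of twist
`b_X` (cf. (16.14)–(16.15), whose «innermost sum `= 1 + O(𝓛⁻⁷)`» is its `Z → 0` limit).
[cite: Zhang2022LandauSiegel, §16 (16.14)–(16.15); §7 (7.2)] -/
def nFac (bX bN Z : ℝ) : ℂ :=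
  ((bX : ℂ) * glPhase ((bX - bN) * Z) - (bN : ℂ)) / ((bX - bN : ℝ) : ℂ)

/-- At `Z = 0` the `N`-factor is `1` (the printed limit). [cite: Zhang2022LandauSiegel, §16 (16.14)–(16.15)] -/
theorem nFac_zero {bX bN : ℝ} (h : bX ≠ bN) : nFac bX bN 0 = 1 := by
  have hne : ((bX - bN : ℝ) : ℂ) ≠ 0 := by exact_mod_cast sub_ne_zero.2 h
  rw [nFac, mul_zero, glPhase_zero, mul_one]
  push_cast at hne ⊢
  exact div_self hne

/-- **The finite-`A` cross weights of D-ELL-1c-II (P3):** `𝒲_j(b, ℓ′) = Φ((b₂ − b_j)ℓ′)·n_j(b)/v_j(b)`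
(`n_j = Π_{k≠j} b_k` = `Det.shiftN`, `v_j = Π_{k≠j}(b_k − b_j)` = `Det.shiftVdm`; `b 2` the apex shift).
[cite: Zhang2022LandauSiegel, §15 (15.24); §16 (16.17); §17 (17.10); §18 (18.1)] -/
def glueWA (b : Fin 3 → ℝ) (ℓ : ℝ) (j : Fin 3) : ℂ :=
  glPhase ((b 2 - b j) * ℓ) * (shiftN b j : ℂ) / (shiftVdm b j : ℂ)

/-- **The finite-`A` formula-I residue weights of D-ELL-1-K0 (R4):** `W_j(b; ℓ′) = b_j·Φ((b₂ − b_j)ℓ′)/v_j(b)`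
(no global phase; at `ℓ′ = 1` on Zhang's ray = `Det.shiftW`, see `ellWA_one_eq_shiftW`).
[cite: Zhang2022LandauSiegel, proof of Prop 7.1, (7.19)–(7.21); Lemma 5.1] -/
def ellWA (b : Fin 3 → ℝ) (ℓ : ℝ) (j : Fin 3) : ℂ :=
  (b j : ℂ) * glPhase ((b 2 - b j) * ℓ) / (shiftVdm b j : ℂ)

/-- **(P5), the split-independence identity:** `b_j·𝒲_j(b,ℓ′) = W_j(b;ℓ′)·n_j(b)` for every triple, every `ℓ′` and
every channel — the finite-`A` analogue of the prior cell's `j·W′_j = W_j·b′_j·b″_j`.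
[cite: Zhang2022LandauSiegel, Prop 14.1; §18 (18.1)] -/
theorem bj_mul_glueWA (b : Fin 3 → ℝ) (ℓ : ℝ) (j : Fin 3) :
    (b j : ℂ) * glueWA b ℓ j = ellWA b ℓ j * (shiftN b j : ℂ) := by
  simp only [glueWA, ellWA]
  ring

/-! ### The finite-`A` pieces of `Φ₁ + Φ₂ − Φ₃` as displayed by D-ELL-1c-II -/

/-- **§15 at finite `A`:** `u_j(ℓ₄) = n₂·Φ((b₂ − b_j)ℓ₄)/v_j` (`n₂ = b₀b₁`; the `K`-frame phase `P₄^{β₃−β_j}` of the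
residues `ϱ_{1j}` of (15.16); at `ℓ₄ = 1` = `Det.glueU`). [cite: Zhang2022LandauSiegel, §15 (15.15)–(15.17), (15.24)] -/
def glueUA (b : Fin 3 → ℝ) (ℓ₄ : ℝ) (j : Fin 3) : ℂ :=
  (shiftN b 2 : ℂ) * glPhase ((b 2 - b j) * ℓ₄) / (shiftVdm b j : ℂ)

/-- **§16 at finite `A`, channel 0:** `Φ((b₂−b₁)ℓ′)·b₀Φ((b₁−b₀)ℓ₄)/(b₁−b₀)·𝒩(b₀,b₂;Z)` (`ℓ₄ = ℓ′ − Z`; on Zhang's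
ray `Φ((b₂−b₁)ℓ′) = Φ(b₀ℓ′)`, the note's display: `glueV0A_ray`). [cite: Zhang2022LandauSiegel, §16 (16.5), (16.13)–(16.17)] -/
def glueV0A (b : Fin 3 → ℝ) (ℓ Z : ℝ) : ℂ :=
  glPhase ((b 2 - b 1) * ℓ) * ((b 0 : ℂ) * glPhase ((b 1 - b 0) * (ℓ - Z)) / ((b 1 - b 0 : ℝ) : ℂ))
    * nFac (b 0) (b 2) Z

/-- **§16 at finite `A`, channel 1:** `Φ((b₂−b₁)ℓ′)·(−b₀/(b₁−b₀))·𝒩(b₁,b₂;Z)`. [cite: Zhang2022LandauSiegel, §16 (16.5), (16.13)–(16.17)] -/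
def glueV1A (b : Fin 3 → ℝ) (ℓ Z : ℝ) : ℂ :=
  glPhase ((b 2 - b 1) * ℓ) * (-(b 0 : ℂ) / ((b 1 - b 0 : ℝ) : ℂ)) * nFac (b 1) (b 2) Z

/-- **§17 at finite `A`, the `Φ₃⁻` channel-0 coefficient** (entering `Φ₁+Φ₂−Φ₃` with `+`):
`Φ((b₂−b₀)ℓ′)·𝒩(b₀,b₁;Z)·𝒩(b₀,b₂;Z)` (on Zhang's ray `Φ((b₂−b₀)ℓ′) = Φ(b₁ℓ′)`, the note's `(pt₀)^{β₂}`: `glueT0A_ray`;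
two `N`-factors). [cite: Zhang2022LandauSiegel, §17 (17.7)–(17.10)] -/
def glueT0A (b : Fin 3 → ℝ) (ℓ Z : ℝ) : ℂ :=
  glPhase ((b 2 - b 0) * ℓ) * nFac (b 0) (b 1) Z * nFac (b 0) (b 2) Z

/-- **The ASSEMBLED cross block at finite `A`** (`−i(Φ₁+Φ₂−Φ₃)` on channel functionals `e_j` and the apex product
`e* = a(0⁺)b′(0⁺)`, apex phase `(pt₀)^{β₃} ↦ Φ(b₂ℓ′)`), with BOTH frame parameters `ℓ′`, `Z` free and `ℓ₄ = ℓ′ − Z`.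
[cite: Zhang2022LandauSiegel, §13 (13.7)–(13.10); §15 (15.24); §16 (16.17); §17 (17.1), (17.6), (17.10)] -/
def glueAssembledA (b : Fin 3 → ℝ) (ℓ Z : ℝ) (e : Fin 3 → ℂ) (e0 : ℂ) : ℂ :=
  -I * ((∑ j : Fin 3, glueUA b (ℓ - Z) j * e j) + glueV0A b ℓ Z * e 0 + glueV1A b ℓ Z * e 1
    - glPhase (b 2 * ℓ) * e0 + glueT0A b ℓ Z * e 0)

variable {b : Fin 3 → ℝ}

/-! ### Channel by channel (every pairwise-distinct non-zero triple, every `ℓ′`, every `Z`) -/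

/-- Channel 2 carries no frame at all: `u₂(ℓ₄) = 𝒲₂(b,ℓ′) = n₂/v₂` for any `ℓ₄`, `ℓ′`.
[cite: Zhang2022LandauSiegel, §15 (15.24)] -/
theorem glueUA_two (b : Fin 3 → ℝ) (ℓ₄ ℓ : ℝ) : glueUA b ℓ₄ 2 = glueWA b ℓ 2 := by
  simp only [glueUA, glueWA, sub_self, zero_mul, glPhase_zero, one_mul, mul_one]

/-- Channel 1: `u₁(ℓ′−Z) + Φ((b₂−b₁)ℓ′)(−b₀/(b₁−b₀))𝒩(b₁,b₂;Z) = 𝒲₁(b,ℓ′)` — the `Z`-dependence cancels.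
[cite: Zhang2022LandauSiegel, §15 (15.24); §16 (16.17)] -/
theorem glue_channel_one (h01 : b 0 ≠ b 1) (h12 : b 1 ≠ b 2) (h0 : b 0 ≠ 0) (ℓ Z : ℝ) :
    glueUA b (ℓ - Z) 1 + glueV1A b ℓ Z = glueWA b ℓ 1 := by
  simp only [glueUA, glueV1A, glueWA, nFac, shiftN, shiftVdm, Matrix.cons_val_one, Matrix.head_cons,
    Matrix.cons_val_zero, Matrix.cons_val_two, Matrix.tail_cons, glPhase_sub_mul, glPhase_mul_sub]
  set L1 := glPhase (b 1 * ℓ) with hL1def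
  set L2 := glPhase (b 2 * ℓ) with hL2def
  set Z1 := glPhase (b 1 * Z) with hZ1def
  set Z2 := glPhase (b 2 * Z) with hZ2def
  have hL1 : L1 ≠ 0 := glPhase_ne_zero _
  have hL2 : L2 ≠ 0 := glPhase_ne_zero _
  have hZ1 : Z1 ≠ 0 := glPhase_ne_zero _
  have hZ2 : Z2 ≠ 0 := glPhase_ne_zero _
  have hb0 : (b 0 : ℂ) ≠ 0 := by exact_mod_cast h0
  have hv1 : ((b 1 - b 0 : ℝ) : ℂ) ≠ 0 := by exact_mod_cast sub_ne_zero.2 h01.symm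
  have hv2 : ((b 0 - b 1 : ℝ) : ℂ) ≠ 0 := by exact_mod_cast sub_ne_zero.2 h01
  have hv3 : ((b 1 - b 2 : ℝ) : ℂ) ≠ 0 := by exact_mod_cast sub_ne_zero.2 h12
  have hv4 : ((b 2 - b 1 : ℝ) : ℂ) ≠ 0 := by exact_mod_cast sub_ne_zero.2 h12.symm
  push_cast at hv1 hv2 hv3 hv4 ⊢
  field_simp
  ring

/-- Channel 0: `u₀(ℓ′−Z) + Φ((b₂−b₁)ℓ′)b₀Φ((b₁−b₀)(ℓ′−Z))/(b₁−b₀)·𝒩(b₀,b₂;Z) + Φ((b₂−b₀)ℓ′)𝒩(b₀,b₁;Z)𝒩(b₀,b₂;Z)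
= 𝒲₀(b,ℓ′)` — the `Z`-dependence cancels. [cite: Zhang2022LandauSiegel, §15 (15.24); §16 (16.17); §17 (17.10)] -/
theorem glue_channel_zero (h01 : b 0 ≠ b 1) (h02 : b 0 ≠ b 2) (h12 : b 1 ≠ b 2) (ℓ Z : ℝ) :
    glueUA b (ℓ - Z) 0 + glueV0A b ℓ Z + glueT0A b ℓ Z = glueWA b ℓ 0 := by
  simp only [glueUA, glueV0A, glueT0A, glueWA, nFac, shiftN, shiftVdm, Matrix.head_cons, Matrix.cons_val_zero,
    Matrix.cons_val_two, Matrix.tail_cons, glPhase_sub_mul, glPhase_mul_sub]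
  set L0 := glPhase (b 0 * ℓ) with hL0def
  set L1 := glPhase (b 1 * ℓ) with hL1def
  set L2 := glPhase (b 2 * ℓ) with hL2def
  set Z0 := glPhase (b 0 * Z) with hZ0def
  set Z1 := glPhase (b 1 * Z) with hZ1def
  set Z2 := glPhase (b 2 * Z) with hZ2def
  have hL0 : L0 ≠ 0 := glPhase_ne_zero _
  have hL1 : L1 ≠ 0 := glPhase_ne_zero _
  have hL2 : L2 ≠ 0 := glPhase_ne_zero _
  have hZ0 : Z0 ≠ 0 := glPhase_ne_zero _
  have hZ1 : Z1 ≠ 0 := glPhase_ne_zero _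
  have hZ2 : Z2 ≠ 0 := glPhase_ne_zero _
  have hv1 : ((b 1 - b 0 : ℝ) : ℂ) ≠ 0 := by exact_mod_cast sub_ne_zero.2 h01.symm
  have hv2 : ((b 0 - b 1 : ℝ) : ℂ) ≠ 0 := by exact_mod_cast sub_ne_zero.2 h01
  have hv3 : ((b 0 - b 2 : ℝ) : ℂ) ≠ 0 := by exact_mod_cast sub_ne_zero.2 h02
  have hv4 : ((b 2 - b 0 : ℝ) : ℂ) ≠ 0 := by exact_mod_cast sub_ne_zero.2 h02.symm
  have hv5 : ((b 2 - b 1 : ℝ) : ℂ) ≠ 0 := by exact_mod_cast sub_ne_zero.2 h12.symm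
  push_cast at hv1 hv2 hv3 hv4 hv5 ⊢
  field_simp
  ring

/-- **(P3) ASSEMBLY AT FINITE `A`, kernel-checked:** for every pairwise-distinct triple with `b₀ ≠ 0`, EVERY `t₀`-frame
`ℓ′` and EVERY `T`-frame `Z`, the assembled block is `−i{Σ_j 𝒲_j(b,ℓ′) e_j − Φ(b₂ℓ′) e*}` — the `N`-factors have
cancelled. [cite: Zhang2022LandauSiegel, §13 (13.7); §15 (15.24); §16 (16.17); §17 (17.10); §18 (18.1)] -/
theorem glueAssembledA_eq (hinj : Function.Injective b) (h0 : b 0 ≠ 0) (ℓ Z : ℝ) (e : Fin 3 → ℂ) (e0 : ℂ) :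
    glueAssembledA b ℓ Z e e0 = -I * ((∑ j : Fin 3, glueWA b ℓ j * e j) - glPhase (b 2 * ℓ) * e0) := by
  have h01 : b 0 ≠ b 1 := fun h => absurd (hinj h) (by decide)
  have h02 : b 0 ≠ b 2 := fun h => absurd (hinj h) (by decide)
  have h12 : b 1 ≠ b 2 := fun h => absurd (hinj h) (by decide)
  rw [glueAssembledA, Fin.sum_univ_three, Fin.sum_univ_three, ← glue_channel_zero h01 h02 h12 ℓ Z,
    ← glue_channel_one h01 h12 h0 ℓ Z, ← glueUA_two b (ℓ - Z) ℓ]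
  ring

/-- **THE `T`-FRAME CANCELS IDENTICALLY:** the assembled finite-`A` block does not depend on `Z = 2B_T/A` — `B_T` is not
a first-order datum of the cross block (frame rule R6 extended to formula II, D-ELL-1c-II (P3)).
[cite: Zhang2022LandauSiegel, §13 (13.7); §16 (16.14)–(16.15); §17 (17.1)] -/
theorem glueAssembledA_T_frame_cancels (hinj : Function.Injective b) (h0 : b 0 ≠ 0) (ℓ Z : ℝ) (e : Fin 3 → ℂ)
    (e0 : ℂ) : glueAssembledA b ℓ Z e e0 = glueAssembledA b ℓ 0 e e0 := by
  rw [glueAssembledA_eq hinj h0, glueAssembledA_eq hinj h0]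

/-- On profile data the finite-`A` block IS the free-pair glue block `Det.F0DetC` with the finite-`A` pair
`(𝒲(b,ℓ′), −Φ(b₂ℓ′))`. [cite: Zhang2022LandauSiegel, Prop 14.1; Lemma 15.1; §18 (18.1)] -/
theorem glueAssembledA_eq_F0DetC (hinj : Function.Injective b) (h0 : b 0 ≠ 0) (ℓ Z : ℝ) (a0 Ia b0 Ib : ℂ) :
    glueAssembledA b ℓ Z (fun j => eDet (b j) a0 Ia * eDet (b j) b0 Ib) (a0 * b0)
      = F0DetC (glueWA b ℓ) (-glPhase (b 2 * ℓ)) b a0 Ia b0 Ib := by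
  rw [glueAssembledA_eq hinj h0, F0DetC]
  ring

/-! ### Zhang's detuning ray `b₂ = b₀ + b₁`: the note's display verbatim -/

/-- On the ray the §16 prefactor is `Φ(b₀ℓ′)` (the note's `e^{iπb₁ℓ′}` in its channel numbering).
[cite: Zhang2022LandauSiegel, §16 (16.17); (2.13)] -/
theorem glueV0A_ray (hray : b 2 = b 0 + b 1) (ℓ Z : ℝ) :
    glueV0A b ℓ Z = glPhase (b 0 * ℓ) * ((b 0 : ℂ) * glPhase ((b 1 - b 0) * (ℓ - Z)) / ((b 1 - b 0 : ℝ) : ℂ))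
      * nFac (b 0) (b 2) Z := by
  rw [glueV0A, hray, add_sub_cancel_right]

/-- On the ray the §16 channel-1 coefficient reads `Φ(b₀ℓ′)(−b₀/(b₁−b₀))𝒩(b₁,b₂;Z)`. [cite: Zhang2022LandauSiegel, §16 (16.17); (2.13)] -/
theorem glueV1A_ray (hray : b 2 = b 0 + b 1) (ℓ Z : ℝ) :
    glueV1A b ℓ Z = glPhase (b 0 * ℓ) * (-(b 0 : ℂ) / ((b 1 - b 0 : ℝ) : ℂ)) * nFac (b 1) (b 2) Z := by
  rw [glueV1A, hray, add_sub_cancel_right]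

/-- On the ray the §17 `Φ₃⁻` prefactor is `Φ(b₁ℓ′)` (the note's `(pt₀)^{β₂} ↦ e^{iπb₂ℓ′}` in its numbering).
[cite: Zhang2022LandauSiegel, §17 (17.7)–(17.10); (2.13)] -/
theorem glueT0A_ray (hray : b 2 = b 0 + b 1) (ℓ Z : ℝ) :
    glueT0A b ℓ Z = glPhase (b 1 * ℓ) * nFac (b 0) (b 1) Z * nFac (b 0) (b 2) Z := by
  rw [glueT0A, hray, add_sub_cancel_left]

/-- On the ray GLUE-DERIVATION's global phase is trivial: `Φ₀ = Φ((b₀+b₁−b₂)/2) = 1` (D-ELL-1c-II: «no residual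
constant phase»). [cite: Zhang2022LandauSiegel, §13 (13.1); Lemma 5.2] -/
theorem gluePhi0_ray (hray : b 2 = b 0 + b 1) : gluePhi0 b = 1 := by
  rw [gluePhi0, hray, show (b 0 + b 1 - (b 0 + b 1)) / 2 = (0 : ℝ) by ring, glPhase_zero]

/-! ### Faithfulness to the tree's limit objects (`ℓ′ = 1`, `Z = 0`) -/

/-- At `ℓ′ = 1`, `Z = 0` the finite-`A` assembly IS `Det.glueAssembled` up to GLUE-DERIVATION's global phase `Φ₀`
(pieces: `u_j(1) = glueU`, `Φ(b₂−b₁)(v¹,v²)`, `−Φ(b₂)𝔢* + Φ(b₂−b₀)𝔢₀`), for every pairwise-distinct triple.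
[cite: Zhang2022LandauSiegel, §13 (13.7)–(13.10); §15 (15.24); §16 (16.17); §17 (17.10)] -/
theorem glueAssembledA_one_zero (hinj : Function.Injective b) (e : Fin 3 → ℂ) (e0 : ℂ) :
    gluePhi0 b * glueAssembledA b 1 0 e e0 = glueAssembled b e e0 := by
  have h01 : b 0 ≠ b 1 := fun h => absurd (hinj h) (by decide)
  have h02 : b 0 ≠ b 2 := fun h => absurd (hinj h) (by decide)
  have h12 : b 1 ≠ b 2 := fun h => absurd (hinj h) (by decide)
  have hV0 : glPhase (b 2 - b 1) * glueV b 0 = glueV0A b 1 0 := by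
    simp only [glueV, glueV0A, Matrix.cons_val_zero, nFac_zero h02, sub_zero, mul_one]
  have hV1 : glPhase (b 2 - b 1) * glueV b 1 = glueV1A b 1 0 := by
    simp only [glueV, glueV1A, Matrix.cons_val_one, Matrix.cons_val_zero, nFac_zero h12, mul_one]
  have hT : glPhase (b 2 - b 0) = glueT0A b 1 0 := by
    rw [glueT0A, nFac_zero h01, nFac_zero h02, mul_one, mul_one, mul_one]
  have hU : ∀ j, glueU b j = glueUA b (1 - 0) j := by
    intro j; simp only [glueU, glueUA, sub_zero, mul_one]
  rw [glueAssembled, glueAssembledA, Fin.sum_univ_three, Fin.sum_univ_three, hU 0, hU 1, hU 2,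
    show glPhase (b 2) = glPhase (b 2 * 1) by rw [mul_one], ← hT,
    show glPhase (b 2 - b 1) * (glueV b 0 * e 0 + glueV b 1 * e 1)
      = (glPhase (b 2 - b 1) * glueV b 0) * e 0 + (glPhase (b 2 - b 1) * glueV b 1) * e 1 by ring, hV0, hV1]
  ring

/-- … so on Zhang's ray (`Φ₀ = 1`) it IS `Det.glueAssembled` on the nose. [cite: Zhang2022LandauSiegel, §13 (13.7)–(13.10); (2.13)] -/
theorem glueAssembledA_one_zero_ray (hinj : Function.Injective b) (hray : b 2 = b 0 + b 1) (e : Fin 3 → ℂ)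
    (e0 : ℂ) : glueAssembledA b 1 0 e e0 = glueAssembled b e e0 := by
  rw [← glueAssembledA_one_zero hinj, gluePhi0_ray hray, one_mul]

/-- At `ℓ′ = 1` on the ray the finite-`A` weight IS the cell's glue weight `W′_j(b) = W_j n_j/b_j` (`Det.shiftGlueW`).
[cite: Zhang2022LandauSiegel, Prop 14.1; §18 (18.1)] -/
theorem glueWA_one_eq_shiftGlueW (hray : b 2 = b 0 + b 1) (j : Fin 3) (hj : b j ≠ 0) :
    glueWA b 1 j = shiftGlueW b j := by
  have hbj : (b j : ℂ) ≠ 0 := by exact_mod_cast hj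
  have hs : (shiftS b j - b j) / 2 = (b 2 - b j) * 1 := by
    fin_cases j <;> (simp [shiftS, hray] <;> ring)
  rw [shiftGlueW, shiftW_eq_glPhase, hs, glueWA]
  field_simp

/-- At `ℓ′ = 1` on the ray the finite-`A` formula-I weight IS `Det.shiftW`. [cite: Zhang2022LandauSiegel, proof of Prop 7.1, (7.19)–(7.21)] -/
theorem ellWA_one_eq_shiftW (hray : b 2 = b 0 + b 1) (j : Fin 3) : ellWA b 1 j = shiftW b j := by
  have hs : (shiftS b j - b j) / 2 = (b 2 - b j) * 1 := by
    fin_cases j <;> (simp [shiftS, hray] <;> ring)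
  rw [shiftW_eq_glPhase, hs, ellWA]

/-- At `ℓ′ = 1` on the ray the apex coefficient IS the cell's glue constant `c₀(b) = −Φ(Σb/2)` (`Det.shiftGlue0`).
[cite: Zhang2022LandauSiegel, Lemma 5.2 p.10; §17 (17.6)] -/
theorem neg_glPhase_apex_eq_shiftGlue0 (hray : b 2 = b 0 + b 1) : -glPhase (b 2 * 1) = shiftGlue0 b := by
  rw [shiftGlue0_eq_glPhase, Fin.sum_univ_three, hray]
  congr 2
  ring

/-- **Model values:** at `b = (1,2,3)`, `ℓ′ = 1` the finite-`A` weights are `(3,3,1)` = `Det.zhangGlueW` (D-ELL-1c-II: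
«`𝒲_j(A) → (3,3,1)`»). [cite: Zhang2022LandauSiegel, §18 (18.1); (15.24); (16.17); (17.10)] -/
theorem glueWA_std : glueWA ![1, 2, 3] 1 = zhangGlueW := by
  have hray : (![1, 2, 3] : Fin 3 → ℝ) 2 = (![1, 2, 3] : Fin 3 → ℝ) 0 + (![1, 2, 3] : Fin 3 → ℝ) 1 := by
    simp; norm_num
  funext j
  have hj : (![1, 2, 3] : Fin 3 → ℝ) j ≠ 0 := by fin_cases j <;> simp
  rw [glueWA_one_eq_shiftGlueW hray j hj, shiftGlueW_std]

/-- … and the apex coefficient is `−Φ(3) = 1` (the printed `+a(0⁺)b(0⁺)` of (18.1)). [cite: Zhang2022LandauSiegel, §18 (18.1); §17 (17.6)] -/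
theorem neg_glPhase_apex_std : -glPhase ((![1, 2, 3] : Fin 3 → ℝ) 2 * 1) = 1 := by
  have hray : (![1, 2, 3] : Fin 3 → ℝ) 2 = (![1, 2, 3] : Fin 3 → ℝ) 0 + (![1, 2, 3] : Fin 3 → ℝ) 1 := by
    simp; norm_num
  rw [neg_glPhase_apex_eq_shiftGlue0 hray, shiftGlue0_std]

end Det

end Literature.NumberTheory.LFunctions.Zhang2022

end
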